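import Summits.AtomisticToContinuum.Crystallization.Theorems.ChartedPlanarOrderProfileSlavingLJBalance
import Summits.AtomisticToContinuum.Crystallization.Theorems.ChartedPlanarOrderCleanStackedIndependent

/-!
# D1a in tree currency: `LayerForceBalance Λ` HOLDS; D1 `NashBalance Λ ⟸ StraddleSummable Λ` (decomp-a2c lens-3 g22)

Blocker `N = ChartedPlanarOrder.ChartedZeroExcessLayered`, PS column: `NashBalance Λ ⟸ LayerForceBalance Λ (D1a) ∧ StraddleSummable Λ (D1s)`
(`…ProfileSlavingLJBalance.nashBalance_of_layerForceBalance`). The analytic content of D1a is PROVED in `…NashForceBalance`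
(`hasSum_layerForce_of_isNash`: separated + single-site Nash + stacked + INDEPENDENT periods ⇒ the other layers' forces on `w m` sum to `0`);
its two side inputs are discharged here: the in-layer cancellation `layerForce a b 0 = 0` (from `layerForce_neg`), and the independence of the
periods, which D1a's binders provide through

* `CleanStackedIndependent` : a `δ`-separated, `(1/16)`-clean, stacked layered set `Layered a b w` has `LinearIndependent ℝ ![a, b]` —
  PROVED in `…CleanStackedIndependent` (`cleanStackedIndependent`; patterns see every direction ⇒ clean sets are `5`-relatively dense ⇒
  dependent periods contradict strictly increasing heights), restated here as a named Prop with its proof `cleanStackedIndependent_holds`.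

Results: ★ `layerForceBalance_holds : LayerForceBalance Λ` (every `Λ`; D1a CLOSED), ★ `nashBalance_of_straddleSummable :
StraddleSummable Λ → NashBalance Λ` (D1 ⟸ D1s alone), `profileSlavingLJ_of_pieces₂ : SlavingKernelL1 → StraddleSummable Λ → TubeMonotone Λ η →
ProfileSlavingLJ Λ η` (E1 `SlavingKernelL1` is proved in `…LayerChainLiouvilleTail`, landing separately; kept as a hypothesis so that this module
does not depend on the landing order). PS column after this module: `ProfileSlavingLJ Λ η ⟸ [E1 ✓] ∧ D1s StraddleSummable Λ ∧ W TubeMonotone Λ η`.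
No new obligations; no instances; no notation.
-/

noncomputable section

open MeasureTheory Set Metric
open scoped RealInnerProductSpace
open Summit.AtomisticToContinuum.Crystallization.Theorems.ChartedPlanarOrderRigidityDoor
open Summit.AtomisticToContinuum.Crystallization.Theorems.ChartedPlanarOrderDensityDichotomy
open Summit.AtomisticToContinuum.Crystallization.Theorems.ChartedPlanarOrderMesoCut
open Summit.AtomisticToContinuum.Crystallization.Theorems.ChartedPlanarOrderDoorLayered (Layered)
open Summit.AtomisticToContinuum.Crystallization.Theorems.ChartedPlanarOrderProfileSlavingLJ
open Summit.AtomisticToContinuum.Crystallization.Theorems.ChartedPlanarOrderProfileSlavingLJBalance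
open Summit.AtomisticToContinuum.Crystallization.Theorems.ChartedPlanarOrderNashForceBalance (hasSum_layerForce_of_isNash)
open Summit.AtomisticToContinuum.Crystallization.Theorems.ChartedPlanarOrderCleanStackedIndependent (cleanStackedIndependent)

namespace Summit.AtomisticToContinuum.Crystallization.Theorems.ChartedPlanarOrderProfileSlavingLJLayerBalance

/-- in-layer cancellation: the force of a full layer on one of its own atoms vanishes (`v ↦ −v` symmetry, `layerForce_neg`). -/
theorem layerForce_zero (a b : E3) : layerForce a b 0 = 0 := by
  have h := layerForce_neg a b 0
  rw [neg_zero] at h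
  have h2 : (2 : ℝ) • layerForce a b 0 = 0 := by rw [two_smul]; nth_rewrite 2 [h]; exact add_neg_cancel _
  exact (smul_eq_zero.mp h2).resolve_left two_ne_zero

/-- **IND «CleanStackedIndependent»** (M · TRUE-type · OWED, critic row 425 (1)): the in-plane periods of a separated, clean, stacked layered
set are linearly independent. (Dependent periods: each layer is a row `w l + ℤc` or a single point; a clean set is relatively dense by a greedy
walk along two-shell neighbours; stacking leaves finitely many layers in any height window; finitely many parallel rows miss a large ball of a slab.) -/
def CleanStackedIndependent : Prop :=
  ∀ δ : ℝ, 0 < δ → ∀ (a b : E3) (w : ℤ → E3),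
    IsSep δ (Layered a b w) → IsClean (μS (Layered a b w)) → IsStacked a b w → LinearIndependent ℝ ![a, b]

/-- IND holds (`…CleanStackedIndependent.cleanStackedIndependent`, same statement). -/
theorem cleanStackedIndependent_holds : CleanStackedIndependent := cleanStackedIndependent

/-- D1a from IND (kept parametric for the record). -/
theorem layerForceBalance_of_indep {Λ : ℝ} (hI : CleanStackedIndependent) : LayerForceBalance Λ :=
  fun δ hδ a b w _ _ hS hC hN hst m => hasSum_layerForce_of_isNash hδ (hI δ hδ a b w hS hC hst) hst hS hN (layerForce_zero a b) m

/-- ★★ **D1a «LayerForceBalance Λ» HOLDS** for every `Λ`. -/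
theorem layerForceBalance_holds (Λ : ℝ) : LayerForceBalance Λ := layerForceBalance_of_indep cleanStackedIndependent_holds

/-- ★ hence D1 `NashBalance Λ ⟸ StraddleSummable Λ` (D1s) alone. -/
theorem nashBalance_of_straddleSummable {Λ : ℝ} (hS : StraddleSummable Λ) : NashBalance Λ :=
  nashBalance_of_layerForceBalance (layerForceBalance_holds Λ) hS

/-- and PS_LJ `ProfileSlavingLJ Λ η ⟸ E1 ∧ D1s ∧ W` (E1 `SlavingKernelL1` proved in `…LayerChainLiouvilleTail`, passed by name once landed). -/
theorem profileSlavingLJ_of_pieces₂ {Λ η : ℝ} (hK : SlavingKernelL1) (hS : StraddleSummable Λ) (hW : TubeMonotone Λ η) :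
    ProfileSlavingLJ Λ η :=
  profileSlavingLJ_of hK (nashBalance_of_straddleSummable hS) hW

end Summit.AtomisticToContinuum.Crystallization.Theorems.ChartedPlanarOrderProfileSlavingLJLayerBalance
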